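import Summits.HubbardSuperconductivity.HubbardSuperconductivity.Theorems.NodalWardXYDefs

/-!
# STRATEGY-CENSUS companion, strategist s1 (crux stmt-HubbardSuperconductivity-10739 `NodalWardXY.PerturbedXYOrder`)

Typed forms of the NEW census attempts of seat `planner-cstrat-stmt-HubbardSuperconductivity-10739-s1-0`
(`Cruxes/PerturbedXYOrder/STRATEGY-CENSUS.md`, revision s1), over the landed vocabulary
`Theorems/NodalWardXYDefs.lean` (`Bond`, `cube`, `cur`, `wJ`, `Wk`, `Zk`, `cratio`, `Admissible`).
Definitions only (statements as signatures) plus two elementary lemmas; NO `sorry`.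

* `§Negation` N7 — `PerturbedXYOrderChargedField`: the crux's zero-freeness claim with the two-current tilt
  replaced by a complex MAGNETIC-FIELD term `η Σ_x cos θ_x`, `‖η‖ ≤ ε`.  Verdict (paper proof in the census,
  all inputs in the tree): FALSE — Lee–Yang pinching in the ordered phase.  It is the typed form of the
  obstruction "any proof of the crux must use the O(2)-INVARIANCE of `W_K`, not only its size / relative form
  bound"; recommended as a `Disproof.lean` target resp. a `Theorems/PerturbedXYOrder/Negative/` lemma
  (`perturbedXYOrder_false_for_charged_field`), next to `…_false_without_lowT` (p73198) and
  `…_false_with_exponent_three` (p122024).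
* `§Strengthen` S6 — `TiltedDecayXY3`: summable (Wick-shaped, dipolar-envelope) DECAY of the tilted truncated
  pair-current correlations at zero-free kernels; the strengthening of the registered stub
  `stub_tiltedCorrelationBounds` (first clause) that a bond-by-bond telescoping induction would need as its
  inductive hypothesis.  `§Decomposition` D6 — `TelescopingGlueXY3`: the provable half of the corresponding
  split (decay along the admissible ray ⇒ bounded tilted pair currents, by the fundamental theorem of calculus
  in the tilt parameter), with the two-point twin `TiltedTwoPointDecayXY3`; the census explains why the open half
  (the decay statements themselves) is HARDER than the stub: the hierarchy of truncated bounds is not closed at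
  any finite order, and proving it meets the factorial/`log L` ring sums of single-scale expansions.
-/

noncomputable section

set_option linter.dupNamespace false

namespace Summit.HubbardSuperconductivity.HubbardSuperconductivity.Cruxes.PerturbedXYOrder.StrategyCensusS1

open MeasureTheory Literature.Probability.LatticeModels
open Summit.HubbardSuperconductivity.HubbardSuperconductivity.Theses.NodalWardXY
open Summit.HubbardSuperconductivity.HubbardSuperconductivity.Theorems.PerturbedXYOrder

/-- The tilted (complex, normalised) expectation `⟨F⟩_K = ∫_cube F w_J e^{W_K} / Z_K` — the object of the
registered stub `stub_tiltedCorrelationBounds`. -/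
def texp {L : ℕ} [NeZero L] (J : ℝ) (K : Bond L → Bond L → ℂ) (F : (TorusSite 3 L → ℝ) → ℂ) : ℂ :=
  (∫ θ in cube L, F θ * (wJ J θ * Complex.exp (Wk K θ))) / Zk J K

/-- The partition function of the rotator with a complex MAGNETIC FIELD `η` (charge-1 perturbation
`η Σ_x cos θ_x`, NOT O(2)-invariant): `Z^field_η = ∫_cube w_J e^{η Σ_x cos θ_x}`. -/
def Zfield {L : ℕ} [NeZero L] (J : ℝ) (η : ℂ) : ℂ :=
  ∫ θ in cube L, wJ J θ * Complex.exp (η * ∑ x : TorusSite 3 L, (Real.cos (θ x) : ℂ))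

/-- **N7 (§Negation) — the charged-field variant; FALSE.**  "Uniform-in-`L` zero-freeness of the low-temperature
rotator under a complex magnetic field of size `≤ ε`."  Paper proof of the NEGATION (census §Negation N7; inputs:
the landed real plateau `realPlateau` (p86048) = `⟨|m_L|²⟩_{J,L} ≥ a₀` for `J ≥ J₁`, `L ≥ 2`; invariance of the cube
integral under the constant shifts `θ ↦ θ + π`, `θ ↦ θ + π/2`; Borel–Carathéodory + Cauchy estimates for the even
holomorphic function `η ↦ L⁻³ log (Z^field_η / Z^field_0)` on a zero-free disc, Mathlib `Complex.borelCaratheodory`):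
for real `η > 0`, `Z^field_η/Z^field_0 ≥ (a₀/8)·exp(η·(√a₀/2)·L³)`, while zero-freeness on `‖η‖ ≤ ε` forces
`|L⁻³ log(Z^field_η/Z^field_0)| ≤ 16 η²/ε` for `0 < η ≤ ε/4`; contradiction once `L³ > 2⁸ log(8/a₀)/(a₀ ε)`.
Hence every proof of `PerturbedXYOrder` must use the O(2)-invariance of `W_K` (no method that only sees
`‖W‖ ≤ C ε L³`, analyticity and `J ≥ J₀` can succeed). -/
def PerturbedXYOrderChargedField : Prop :=
  ∃ J₀ ε : ℝ, 0 < ε ∧ ∀ J : ℝ, J₀ ≤ J → ∀ (L : ℕ) [NeZero L], 2 ≤ L →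
    ∀ η : ℂ, ‖η‖ ≤ ε → Zfield (L := L) J η ≠ 0

/-- The dipolar envelope `(1 + dist(x,x'))⁻³` (size of the spin-wave current–current covariance). -/
def dip (L : ℕ) (b b' : Bond L) : ℝ := 1 / (1 + ((torusGraph 3 L).dist b.1 b'.1 : ℝ)) ^ 3

theorem dip_nonneg {L : ℕ} (b b' : Bond L) : 0 ≤ dip L b b' := by unfold dip; positivity

theorem dip_le_one {L : ℕ} (b b' : Bond L) : dip L b b' ≤ 1 := by
  unfold dip
  rw [div_le_one (by positivity)]
  exact one_le_pow₀ (le_add_of_nonneg_right (by positivity))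

/-- **S6 (§Strengthen) — decay of the tilted truncated pair-current correlations.**  At every admissible kernel with
`Z_K ≠ 0`, the tilted 4-current expectation factorises up to a Wick-shaped dipolar error:
`‖⟨j₁j₂j₃j₄⟩_K − ⟨j₁j₂⟩_K ⟨j₃j₄⟩_K‖ ≤ C (D₁₃D₂₄ + D₁₄D₂₃)`, `D = (1+dist)⁻³`, uniformly in `L`, `J ≥ J₀`.
True at the Gaussian (spin-wave) level; yields the first clause of `stub_tiltedCorrelationBounds` via
`TelescopingGlueXY3`; NOT inductively closed (census §Strengthen S6). -/
def TiltedDecayXY3 : Prop :=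
  ∃ J₀ ε₂ C : ℝ, 0 < ε₂ ∧ 0 < C ∧ ∀ J : ℝ, J₀ ≤ J → ∀ (L : ℕ) [NeZero L], 2 ≤ L →
    ∀ K : Bond L → Bond L → ℂ, Admissible L ε₂ K → Zk J K ≠ 0 →
      ∀ b₁ b₂ b₃ b₄ : Bond L,
        ‖texp J K (fun θ => (cur b₁ θ : ℂ) * (cur b₂ θ : ℂ) * (cur b₃ θ : ℂ) * (cur b₄ θ : ℂ))
            - texp J K (fun θ => (cur b₁ θ : ℂ) * (cur b₂ θ : ℂ))
              * texp J K (fun θ => (cur b₃ θ : ℂ) * (cur b₄ θ : ℂ))‖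
          ≤ C * (dip L b₁ b₃ * dip L b₂ b₄ + dip L b₁ b₄ * dip L b₂ b₃)

/-- The first clause of the registered stub on its own: bounded tilted pair currents at zero-free admissible
kernels (`TiltedCorrelationBoundsXY3` of `EngineStatementTilted.lean` is this ∧ the two-point clause, up to packaging). -/
def TiltedPairCurrentBoundsXY3 : Prop :=
  ∃ J₀ ε₂ C : ℝ, 0 < ε₂ ∧ 0 < C ∧ ∀ J : ℝ, J₀ ≤ J → ∀ (L : ℕ) [NeZero L], 2 ≤ L →
    ∀ K : Bond L → Bond L → ℂ, Admissible L ε₂ K → Zk J K ≠ 0 →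
      ∀ b b' : Bond L, ‖texp J K (fun θ => (cur b θ : ℂ) * (cur b' θ : ℂ))‖ ≤ C

/-- The second clause of the registered stub on its own: bounded tilted two-point function at arbitrary separation. -/
def TiltedTwoPointBoundsXY3 : Prop :=
  ∃ J₀ ε₂ C : ℝ, 0 < ε₂ ∧ 0 < C ∧ ∀ J : ℝ, J₀ ≤ J → ∀ (L : ℕ) [NeZero L], 2 ≤ L →
    ∀ K : Bond L → Bond L → ℂ, Admissible L ε₂ K → Zk J K ≠ 0 →
      ∀ x y : TorusSite 3 L, ‖texp J K (fun θ => (Real.cos (θ x - θ y) : ℂ))‖ ≤ C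

/-- The gradient-of-Green envelope `(1 + dist(x, b))⁻²` (size of the spin-wave covariance `⟨(θ_x − θ_y) ∇_b θ⟩` near `x`). -/
def genv (L : ℕ) (x : TorusSite 3 L) (b : Bond L) : ℝ := 1 / (1 + ((torusGraph 3 L).dist x b.1 : ℝ)) ^ 2

/-- **S6′ (§Strengthen) — decay of the tilted truncated (two-point × pair-current) correlations**, Wick-shaped:
`‖⟨cos(θ_x−θ_y) j₃ j₄⟩_K − ⟨cos(θ_x−θ_y)⟩_K ⟨j₃j₄⟩_K‖ ≤ C (E_{x3}+E_{y3})(E_{x4}+E_{y4})`, `E = (1+dist)⁻²`; sums against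
an admissible kernel to `≤ c ε` uniformly in `x, y, L` (`Σ_ρ ρ² ρ⁻⁴ < ∞`), so it telescopes to the stub's SECOND clause exactly as
`TiltedDecayXY3` does to the first.  Same verdict: true at spin-wave level, not inductively closed. -/
def TiltedTwoPointDecayXY3 : Prop :=
  ∃ J₀ ε₂ C : ℝ, 0 < ε₂ ∧ 0 < C ∧ ∀ J : ℝ, J₀ ≤ J → ∀ (L : ℕ) [NeZero L], 2 ≤ L →
    ∀ K : Bond L → Bond L → ℂ, Admissible L ε₂ K → Zk J K ≠ 0 →
      ∀ (x y : TorusSite 3 L) (b₃ b₄ : Bond L),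
        ‖texp J K (fun θ => (Real.cos (θ x - θ y) : ℂ) * (cur b₃ θ : ℂ) * (cur b₄ θ : ℂ))
            - texp J K (fun θ => (Real.cos (θ x - θ y) : ℂ))
              * texp J K (fun θ => (cur b₃ θ : ℂ) * (cur b₄ θ : ℂ))‖
          ≤ C * ((genv L x b₃ + genv L y b₃) * (genv L x b₄ + genv L y b₄))

/-- **D6 (§Decomposition) — the provable half of the telescoping split.**  Decay along the admissible ray
`t K`, `t ∈ [0,1]` (all admissible, hence zero-free by the hypotheses applied pointwise) gives the stub-shaped bounds:
`d/dt ⟨F⟩_{tK} = Σ_{b₃b₄} K(b₃,b₄) ⟨F ; j_{b₃} j_{b₄}⟩_{tK}` for `F = j_b j_b'` resp. `cos(θ_x − θ_y)`, and the Wick-shaped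
envelopes sum against `ε(1+d₃₄)⁻⁴` to `≤ c ε` uniformly in `L` (power counting `Σ_ρ ρ² ρ⁻³ ρ⁻³ < ∞`, `Σ_ρ ρ² ρ⁻⁴ < ∞` in `d = 3`).
Provable (size M, the discrete/FTC twin of the landed `stub_complexStabilityOfTiltedBounds`); NOT filed, because the open half
`TiltedDecayXY3 ∧ TiltedTwoPointDecayXY3` is harder than the stub it would split (census D6). -/
def TelescopingGlueXY3 : Prop :=
  TiltedDecayXY3 → TiltedTwoPointDecayXY3 → TiltedPairCurrentBoundsXY3 ∧ TiltedTwoPointBoundsXY3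

end Summit.HubbardSuperconductivity.HubbardSuperconductivity.Cruxes.PerturbedXYOrder.StrategyCensusS1

end
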